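import Literature.AnabelianGeometry.EtaleTheta.Discharge.Sec5Prop52iOfConnectedTemperoid
import HarnessLib

/-!
# [EtTh] Prop. 5.2 (i): the SECOND alternative is unconditional at the genuine §5 data; the node's residual is exactly the FIRST alternative

Mochizuki, *The étale theta function …*, Publ. RIMS **45** (2009), Prop. 5.2 (i) p.324 (PDF p.98; kurims ms p.89):
"The pair of morphisms of `C` determined by `s_{l·N}`, `τ_{l·N}` constitutes an `l·N`-th root of a right fraction-pair
[cf. Proposition 4.2, (iii)] of … the theta function `Θ̈` of Proposition 1.4, or, alternatively, an `N`-th root of a right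
fraction-pair … of … an `l`-th root of the theta function `Θ̈` [cf. Remark 4.3.2]."
[cite: MochizukiEtTh2009, Prop 5.2 (i) p.324 (PDF p.98)]

abc-iut cell, block C / W6 tranche-2 row d085 = cone node `EtTh:Prop5.2(i)` (class T of
`plan/L2/W6-TRANCHE-2-L2-NOTES.md`: "BY CONSTRUCTION at the genuine data; 1st alt. p428278/p428578 ⟸ closure data").
PROOF-ONLY companion (no definitions, no new named facts) of abc-iut-L2-t4's W3-L2-01 files
(`FrobenioidThetaOfBiKummerData.lean`, `Discharge/Sec5OfConnectedTemperoid.lean`,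
`Discharge/Sec5Prop52iOfConnectedTemperoid.lean`); nothing of theirs is restated, every input is consumed BY NAME.

The typed node `FrobenioidThetaBiKummer.ThetaPairIsRoot 𝔉 V` is the CONJUNCTION of the two printed alternatives.  At the
assembled §5 data the tree so far records the conjunction only modulo the Rmk. 4.3.2 composite-root binder `hcomp`
(`thetaPairIsRoot_ofBiKummerData`; `hcomp ⟸` the closure inputs (C1)(C1′)(C2) of GAP rows G-L2t4-1a/1b via
abc-iut-w5-d234's `BiKummerSetting.NthRoot.hcomp_of`, `thetaPairIsRoot_ofConnectedTemperoidData(_of_pullFracModel)`), although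
its proof uses `hcomp` for the FIRST alternative only.  This file separates the clauses in the kernel:

* `thetaPairIsRoot_second_ofBiKummerData` — the SECOND printed alternative ("an `N`-th root of a right fraction-pair of an
  `l`-th root of `Θ̈`", the second conjunct of `ThetaPairIsRoot` verbatim) holds for the assembled data
  `ThetaFrobenioid.ofBiKummerData` with NO closure input (only the dictionary bijectivity `hbij` and the identity law of the
  pull-back `hpull_id`, both theorems at the genuine instances);
* `thetaPairIsRoot_ofBiKummerData_iff` — hence the typed node at the assembled data is EQUIVALENT to its first alternative,
  i.e. to the binder `hcomp : S.PairIsNthRootOf pullFrac (l·N) θ s^⊓_N s^⊔_N` (residual isolation: the node's only open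
  content is G-L2t4-1a/1b);
* the same two statements at the §5 data over the genuine connected base `B^temp(Π^tp_X)⁰`
  (`ofConnectedTemperoidData`): `thetaPairIsRoot_second_ofConnectedTemperoidData`,
  `thetaPairIsRoot_ofConnectedTemperoidData_iff`, and with abc-iut-L2-t9's model pull-back `pullFracModel`, where the
  identity law is the theorem `pullFracModel_id`: `thetaPairIsRoot_second_ofConnectedTemperoidData_of_pullFracModel`
  (UNCONDITIONAL), `thetaPairIsRoot_ofConnectedTemperoidData_iff_of_pullFracModel`.

HONEST FRAMING: per-clause bookkeeping of a landed construction; the print's identification of the pair with the §1 sections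
`s_{l·N}`, `τ_{l·N}` (the §1 incarnation, MERGE-PLAN row 5 of abc-iut-L2-t4) is not typed in the tree and is not touched here;
typed ≠ proved for the first alternative; nothing here takes a side on [IUTchIII] Cor. 3.12.
-/

noncomputable section

namespace Literature.AnabelianGeometry.EtaleTheta

open CategoryTheory Opposite Literature.AlgebraicGeometry.Frobenioids Literature.AnabelianGeometry.SemiGraphs
  Literature.AnabelianGeometry.SemiGraphs.GaloisObjects

universe u₀ v₀ u v w

namespace ThetaFrobenioid

/-! ### At the §5 data assembled over an arbitrary §4 setting (`ofBiKummerData`) -/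

section Assembled

variable {K : Type u₀} [Field K] {X : SemiGraphs.TemperedArithmeticGroup.{u₀} K} {D₀ : Type u₀} [Category.{v₀} D₀]
  {V : FrdIMonoidStub.{w}} {T₀ : RealifiedDivisorMonoids (D₀ := D₀) V} {D : Type u} [Category.{v} D]
  {VD : FrdICatStub.{u, v, w} D} {S : BiKummerSetting X T₀ D VD}
  {pullFrac : ∀ {A A' : S.C} (_ : A' ⟶ A), S.biratUnits A → S.biratUnits A'}
  {lv N : ℕ+} {T : ThetaEnvData.{max v w} N} {θ : S.biratUnits S.Aodot} {Bl : S.C}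
  {Pl : S.FractionPair θ Bl} {Rl : S.NthRoot θ Pl lv pullFrac}
  (h : ModelFrobenioid.Hypotheses S.tf.divisorMonoid S.tf.ratFnFunctor)
  (toB : ∀ A : S.C, S.biratUnits A →* S.tf.biratUnitsModel A) (Q : FrobenioidTheta.ThetaSubquotientStub.{w} D)
  (odd_l : Odd (lv : ℕ)) (R : S.NthRoot Rl.root Rl.pair N pullFrac) (ιX : T.PiX ≃ₜ* X.Pi)
  (hopen : IsOpen ((S.galoisSurj R.AN.base R.αData.isGalois).ker : Set X.Pi)) (σ : Aut R.AN.base →* Aut R.AN)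
  (K' : Type w) [Field K'] (constEmb : K'ˣ →* S.tf.biratUnitsModel R.BN)
  (constEmb_injective : Function.Injective constEmb)
  (hdivc : ∀ g : Aut R.BN.base,
    ModelFrobenioid.div ((σ ((BiKummerSetting.NthRoot.baseIso S R).conjAut.symm g)).hom ≫ R.pair.num) =
      ModelFrobenioid.div R.pair.num)
  (hdivp : ∀ y : T.PiYdd,
    ModelFrobenioid.div ((σ (S.galoisSurj R.AN.base R.αData.isGalois (ιX y.1))).hom ≫ R.pair.den) =
      ModelFrobenioid.div R.pair.den)

/-- **[EtTh] Prop. 5.2 (i), SECOND alternative, for the assembled §5 data — unconditionally** (no Rmk. 4.3.2 closure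
input): in the real vocabulary `BiKummerVocabStub.ofBiKummerSetting` (dictionary `toB` bijective), "`(s^⊓_N, s^⊔_N)`
constitutes an `N`-th root of a right fraction-pair of an `l`-th root of the theta function `Θ̈`" — the witness being the
`l`-th root `Rl.root` read through `toB` (`isNthRoot_lthRoot`, `pairIsNthRoot_ofBiKummerData`).  This is the second conjunct
of the typed node `FrobenioidThetaBiKummer.ThetaPairIsRoot` verbatim. [cite: MochizukiEtTh2009, Prop 5.2 (i) p.324 (PDF p.98)] -/
theorem thetaPairIsRoot_second_ofBiKummerData (hbij : ∀ A : S.C, Function.Bijective (toB A))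
    (hpull_id : ∀ (A : S.C) (x : S.biratUnits A), pullFrac (𝟙 A) x = x) :
    ∃ (A' : S.C)
      (g : (ofBiKummerData h toB Q odd_l R ιX hopen σ K' constEmb constEmb_injective hdivc hdivp).biratUnits A'),
      (FrobenioidThetaBiKummer.BiKummerVocabStub.ofBiKummerSetting S pullFrac
          (ofBiKummerData h toB Q odd_l R ιX hopen σ K' constEmb constEmb_injective hdivc hdivp)
          fun A => (MulEquiv.ofBijective (toB A) (hbij A)).symm).IsRootOf
        (ofBiKummerData h toB Q odd_l R ιX hopen σ K' constEmb constEmb_injective hdivc hdivp).l g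
        (ofBiKummerData h toB Q odd_l R ιX hopen σ K' constEmb constEmb_injective hdivc hdivp).thetaFn ∧
      (FrobenioidThetaBiKummer.BiKummerVocabStub.ofBiKummerSetting S pullFrac
          (ofBiKummerData h toB Q odd_l R ιX hopen σ K' constEmb constEmb_injective hdivc hdivp)
          fun A => (MulEquiv.ofBijective (toB A) (hbij A)).symm).IsRootOfRightFractionPair
        (ofBiKummerData h toB Q odd_l R ιX hopen σ K' constEmb constEmb_injective hdivc hdivp).N g
        (ofBiKummerData h toB Q odd_l R ιX hopen σ K' constEmb constEmb_injective hdivc hdivp).sCap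
        (ofBiKummerData h toB Q odd_l R ιX hopen σ K' constEmb constEmb_injective hdivc hdivp).sCup := by
  have hθ : (MulEquiv.ofBijective (toB S.Aodot) (hbij S.Aodot)).symm (toB S.Aodot θ) = θ :=
    (MulEquiv.ofBijective (toB S.Aodot) (hbij S.Aodot)).symm_apply_apply θ
  have hg : (MulEquiv.ofBijective (toB Rl.AN) (hbij Rl.AN)).symm (toB Rl.AN Rl.root) = Rl.root :=
    (MulEquiv.ofBijective (toB Rl.AN) (hbij Rl.AN)).symm_apply_apply Rl.root
  change ∃ (A' : S.C) (g : S.tf.biratUnitsModel A'),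
      S.IsNthRootOf pullFrac lv ((MulEquiv.ofBijective (toB A') (hbij A')).symm g)
        ((MulEquiv.ofBijective (toB S.Aodot) (hbij S.Aodot)).symm (toB S.Aodot θ)) ∧
      S.PairIsNthRootOf pullFrac N ((MulEquiv.ofBijective (toB A') (hbij A')).symm g) R.pair.num R.pair.den
  rw [hθ]
  refine ⟨Rl.AN, toB Rl.AN Rl.root, ?_, ?_⟩
  · rw [hg]
    exact isNthRoot_lthRoot hpull_id
  · rw [hg]
    exact S.pairIsNthRootOf_nthRoot pullFrac R

/-- **Residual isolation for the node `EtTh:Prop5.2(i)` at the assembled data**: the typed Prop. 5.2 (i)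
(`ThetaPairIsRoot`, the conjunction of both printed alternatives) is EQUIVALENT to its first alternative alone — the Rmk. 4.3.2
composite-root statement `hcomp` "an `N`-th root of an `l`-th root of `Θ̈` is an `l·N`-th root of `Θ̈`" (GAP row G-L2t4-1,
split G-L2t4-1a/1b; derived from the closure inputs by `BiKummerSetting.NthRoot.hcomp_of`).
[cite: MochizukiEtTh2009, Prop 5.2 (i) p.324 (PDF p.98); Rmk 4.3.2 p.318 (PDF p.92)] -/
theorem thetaPairIsRoot_ofBiKummerData_iff (hbij : ∀ A : S.C, Function.Bijective (toB A))
    (hpull_id : ∀ (A : S.C) (x : S.biratUnits A), pullFrac (𝟙 A) x = x) :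
    FrobenioidThetaBiKummer.ThetaPairIsRoot
        (ofBiKummerData h toB Q odd_l R ιX hopen σ K' constEmb constEmb_injective hdivc hdivp)
        (FrobenioidThetaBiKummer.BiKummerVocabStub.ofBiKummerSetting S pullFrac _
          fun A => (MulEquiv.ofBijective (toB A) (hbij A)).symm) ↔
      S.PairIsNthRootOf pullFrac ((lv : ℕ) * N) θ R.pair.num R.pair.den := by
  refine ⟨fun hT => ?_, thetaPairIsRoot_ofBiKummerData h toB Q odd_l R ιX hopen σ K' constEmb constEmb_injective
    hdivc hdivp hbij hpull_id⟩
  have hθ : (MulEquiv.ofBijective (toB S.Aodot) (hbij S.Aodot)).symm (toB S.Aodot θ) = θ :=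
    (MulEquiv.ofBijective (toB S.Aodot) (hbij S.Aodot)).symm_apply_apply θ
  have h1 := hT.1
  change S.PairIsNthRootOf pullFrac ((lv : ℕ) * (N : ℕ))
      ((MulEquiv.ofBijective (toB S.Aodot) (hbij S.Aodot)).symm (toB S.Aodot θ)) R.pair.num R.pair.den at h1
  rw [hθ] at h1
  exact h1

end Assembled

/-! ### At the §5 data over the genuine connected base `B^temp(Π^tp_X)⁰` (`ofConnectedTemperoidData`) -/

section Connected

variable {K : Type u₀} [Field K] {X : SemiGraphs.TemperedArithmeticGroup.{u₀} K} {D₀ : Type u₀} [Category.{v₀} D₀]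
  {V : FrdIMonoidStub.{w}} {T₀ : RealifiedDivisorMonoids (D₀ := D₀) V}
  {VD : FrdICatStub.{u₀ + 1, u₀, w} (ConnectedPart (BTemp X.Pi))}
  {tf : TemperedFrobenioid T₀ (ConnectedPart (BTemp X.Pi)) VD} {hZ : tf.monoidType = MonoidType.Z}
  {hP : ∀ A : (ConnectedPart (BTemp X.Pi))ᵒᵖ, IsPerfect (tf.Φ.carrier A)}
  {NH : Subgroup (Field.absoluteGaloisGroup K) → tf.category → ℕ+ → Prop} {A₀ : tf.category}
  {hA₀ : PreFrobenioid.IsFrobeniusTrivial tf.toElem A₀} {hA₀' : SemiGraphs.IsGaloisObj A₀.base.obj}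
  {pullFrac : ∀ {A A' : (BiKummerSetting.mkOfConnectedTemperoid X tf hZ hP NH A₀ hA₀ hA₀').C} (_ : A' ⟶ A),
    (BiKummerSetting.mkOfConnectedTemperoid X tf hZ hP NH A₀ hA₀ hA₀').biratUnits A →
      (BiKummerSetting.mkOfConnectedTemperoid X tf hZ hP NH A₀ hA₀ hA₀').biratUnits A'}
  {lv N : ℕ+} {T : ThetaEnvData.{max u₀ w} N}
  {θ : (BiKummerSetting.mkOfConnectedTemperoid X tf hZ hP NH A₀ hA₀ hA₀').biratUnits
    (BiKummerSetting.mkOfConnectedTemperoid X tf hZ hP NH A₀ hA₀ hA₀').Aodot}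
  {Bl : (BiKummerSetting.mkOfConnectedTemperoid X tf hZ hP NH A₀ hA₀ hA₀').C}
  {Pl : (BiKummerSetting.mkOfConnectedTemperoid X tf hZ hP NH A₀ hA₀ hA₀').FractionPair θ Bl}
  {Rl : (BiKummerSetting.mkOfConnectedTemperoid X tf hZ hP NH A₀ hA₀ hA₀').NthRoot θ Pl lv pullFrac}
  (h : ModelFrobenioid.Hypotheses tf.divisorMonoid tf.ratFnFunctor)
  (Q : FrobenioidTheta.ThetaSubquotientStub.{w} (ConnectedPart (BTemp X.Pi))) (odd_l : Odd (lv : ℕ))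
  (R : (BiKummerSetting.mkOfConnectedTemperoid X tf hZ hP NH A₀ hA₀ hA₀').NthRoot Rl.root Rl.pair N pullFrac)
  (ιX : T.PiX ≃ₜ* X.Pi) (K' : Type w) [Field K'] (constEmb : K'ˣ →* tf.biratUnitsModel R.BN)
  (constEmb_injective : Function.Injective constEmb)
  (hinvc : ∀ g : Aut R.AN.base,
    pull tf.divisorMonoid g.hom (ModelFrobenioid.div R.pair.num) = ModelFrobenioid.div R.pair.num)
  (hinvp : ∀ y : T.PiX, y ∈ T.PiYdd →
    pull tf.divisorMonoid ((BiKummerSetting.mkOfConnectedTemperoid X tf hZ hP NH A₀ hA₀ hA₀').galoisSurj R.AN.base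
      R.αData.isGalois (ιX y)).hom (ModelFrobenioid.div R.pair.den) = ModelFrobenioid.div R.pair.den)

/-- **[EtTh] Prop. 5.2 (i), SECOND alternative, for the §5 data over `B^temp(Π^tp_X)⁰`** — modulo only the identity law of
the chosen pull-back rendering `pullFrac` (the dictionary is the identity here). [cite: MochizukiEtTh2009, Prop 5.2 (i) p.324 (PDF p.98)] -/
theorem thetaPairIsRoot_second_ofConnectedTemperoidData
    (hpull_id : ∀ (A : (BiKummerSetting.mkOfConnectedTemperoid X tf hZ hP NH A₀ hA₀ hA₀').C)
      (x : (BiKummerSetting.mkOfConnectedTemperoid X tf hZ hP NH A₀ hA₀ hA₀').biratUnits A), pullFrac (𝟙 A) x = x) :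
    ∃ (A' : (BiKummerSetting.mkOfConnectedTemperoid X tf hZ hP NH A₀ hA₀ hA₀').C)
      (g : (ofConnectedTemperoidData h Q odd_l R ιX K' constEmb constEmb_injective hinvc hinvp).biratUnits A'),
      (FrobenioidThetaBiKummer.BiKummerVocabStub.ofBiKummerSetting
          (BiKummerSetting.mkOfConnectedTemperoid X tf hZ hP NH A₀ hA₀ hA₀') pullFrac
          (ofConnectedTemperoidData h Q odd_l R ιX K' constEmb constEmb_injective hinvc hinvp)
          fun _ => (MulEquiv.ofBijective (MonoidHom.id _) Function.bijective_id).symm).IsRootOf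
        (ofConnectedTemperoidData h Q odd_l R ιX K' constEmb constEmb_injective hinvc hinvp).l g
        (ofConnectedTemperoidData h Q odd_l R ιX K' constEmb constEmb_injective hinvc hinvp).thetaFn ∧
      (FrobenioidThetaBiKummer.BiKummerVocabStub.ofBiKummerSetting
          (BiKummerSetting.mkOfConnectedTemperoid X tf hZ hP NH A₀ hA₀ hA₀') pullFrac
          (ofConnectedTemperoidData h Q odd_l R ιX K' constEmb constEmb_injective hinvc hinvp)
          fun _ => (MulEquiv.ofBijective (MonoidHom.id _) Function.bijective_id).symm).IsRootOfRightFractionPair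
        (ofConnectedTemperoidData h Q odd_l R ιX K' constEmb constEmb_injective hinvc hinvp).N g
        (ofConnectedTemperoidData h Q odd_l R ιX K' constEmb constEmb_injective hinvc hinvp).sCap
        (ofConnectedTemperoidData h Q odd_l R ιX K' constEmb constEmb_injective hinvc hinvp).sCup :=
  thetaPairIsRoot_second_ofBiKummerData h _ Q odd_l R ιX _ _ K' constEmb constEmb_injective _ _
    (fun _ => Function.bijective_id) hpull_id

/-- **[EtTh] Prop. 5.2 (i), SECOND alternative, over `B^temp(Π^tp_X)⁰` with the MODEL pull-back — UNCONDITIONAL**: for any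
rendering `pullFrac` agreeing with abc-iut-L2-t9's `pullFracModel = ((α')^birat)^*` the identity law is the theorem
`pullFracModel_id`, so "`(s^⊓_N, s^⊔_N)` is an `N`-th root of a right fraction-pair of an `l`-th root of `Θ̈`" holds with no
residual input at the genuine §5 data. [cite: MochizukiEtTh2009, Prop 5.2 (i) p.324 (PDF p.98)] -/
theorem thetaPairIsRoot_second_ofConnectedTemperoidData_of_pullFracModel
    (hF : ∀ {B B' : (BiKummerSetting.mkOfConnectedTemperoid X tf hZ hP NH A₀ hA₀ hA₀').C} (ψ : B' ⟶ B)
      (y : (BiKummerSetting.mkOfConnectedTemperoid X tf hZ hP NH A₀ hA₀ hA₀').biratUnits B),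
      pullFrac ψ y = tf.pullFracModel ψ y) :
    ∃ (A' : (BiKummerSetting.mkOfConnectedTemperoid X tf hZ hP NH A₀ hA₀ hA₀').C)
      (g : (ofConnectedTemperoidData h Q odd_l R ιX K' constEmb constEmb_injective hinvc hinvp).biratUnits A'),
      (FrobenioidThetaBiKummer.BiKummerVocabStub.ofBiKummerSetting
          (BiKummerSetting.mkOfConnectedTemperoid X tf hZ hP NH A₀ hA₀ hA₀') pullFrac
          (ofConnectedTemperoidData h Q odd_l R ιX K' constEmb constEmb_injective hinvc hinvp)
          fun _ => (MulEquiv.ofBijective (MonoidHom.id _) Function.bijective_id).symm).IsRootOf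
        (ofConnectedTemperoidData h Q odd_l R ιX K' constEmb constEmb_injective hinvc hinvp).l g
        (ofConnectedTemperoidData h Q odd_l R ιX K' constEmb constEmb_injective hinvc hinvp).thetaFn ∧
      (FrobenioidThetaBiKummer.BiKummerVocabStub.ofBiKummerSetting
          (BiKummerSetting.mkOfConnectedTemperoid X tf hZ hP NH A₀ hA₀ hA₀') pullFrac
          (ofConnectedTemperoidData h Q odd_l R ιX K' constEmb constEmb_injective hinvc hinvp)
          fun _ => (MulEquiv.ofBijective (MonoidHom.id _) Function.bijective_id).symm).IsRootOfRightFractionPair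
        (ofConnectedTemperoidData h Q odd_l R ιX K' constEmb constEmb_injective hinvc hinvp).N g
        (ofConnectedTemperoidData h Q odd_l R ιX K' constEmb constEmb_injective hinvc hinvp).sCap
        (ofConnectedTemperoidData h Q odd_l R ιX K' constEmb constEmb_injective hinvc hinvp).sCup :=
  thetaPairIsRoot_second_ofConnectedTemperoidData h Q odd_l R ιX K' constEmb constEmb_injective hinvc hinvp
    (fun A x => by rw [hF]; exact tf.pullFracModel_id A x)

/-- **Residual isolation for `EtTh:Prop5.2(i)` over `B^temp(Π^tp_X)⁰`**: the typed Prop. 5.2 (i) at the genuine §5 data is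
EQUIVALENT to its first alternative `hcomp` (GAP G-L2t4-1 = G-L2t4-1a/1b via `NthRoot.hcomp_of`), modulo the identity law of
`pullFrac`. [cite: MochizukiEtTh2009, Prop 5.2 (i) p.324 (PDF p.98); Rmk 4.3.2 p.318 (PDF p.92)] -/
theorem thetaPairIsRoot_ofConnectedTemperoidData_iff
    (hpull_id : ∀ (A : (BiKummerSetting.mkOfConnectedTemperoid X tf hZ hP NH A₀ hA₀ hA₀').C)
      (x : (BiKummerSetting.mkOfConnectedTemperoid X tf hZ hP NH A₀ hA₀ hA₀').biratUnits A), pullFrac (𝟙 A) x = x) :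
    FrobenioidThetaBiKummer.ThetaPairIsRoot
        (ofConnectedTemperoidData h Q odd_l R ιX K' constEmb constEmb_injective hinvc hinvp)
        (FrobenioidThetaBiKummer.BiKummerVocabStub.ofBiKummerSetting
          (BiKummerSetting.mkOfConnectedTemperoid X tf hZ hP NH A₀ hA₀ hA₀') pullFrac _
          fun _ => (MulEquiv.ofBijective (MonoidHom.id _) Function.bijective_id).symm) ↔
      (BiKummerSetting.mkOfConnectedTemperoid X tf hZ hP NH A₀ hA₀ hA₀').PairIsNthRootOf pullFrac ((lv : ℕ) * N) θ
        R.pair.num R.pair.den :=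
  thetaPairIsRoot_ofBiKummerData_iff h _ Q odd_l R ιX _ _ K' constEmb constEmb_injective _ _
    (fun _ => Function.bijective_id) hpull_id

/-- **Residual isolation over `B^temp(Π^tp_X)⁰` with the MODEL pull-back**: for `pullFrac` agreeing with `pullFracModel`,
the typed Prop. 5.2 (i) at the genuine §5 data is EQUIVALENT to its first alternative `hcomp` outright — so, with
`thetaPairIsRoot_ofConnectedTemperoidData_of_pullFracModel` (p428278), the node's open content is exactly the closure
inputs (C1)(C1′)(C2) of G-L2t4-1a/1b. [cite: MochizukiEtTh2009, Prop 5.2 (i) p.324 (PDF p.98); Rmk 4.3.2 p.318 (PDF p.92)] -/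
theorem thetaPairIsRoot_ofConnectedTemperoidData_iff_of_pullFracModel
    (hF : ∀ {B B' : (BiKummerSetting.mkOfConnectedTemperoid X tf hZ hP NH A₀ hA₀ hA₀').C} (ψ : B' ⟶ B)
      (y : (BiKummerSetting.mkOfConnectedTemperoid X tf hZ hP NH A₀ hA₀ hA₀').biratUnits B),
      pullFrac ψ y = tf.pullFracModel ψ y) :
    FrobenioidThetaBiKummer.ThetaPairIsRoot
        (ofConnectedTemperoidData h Q odd_l R ιX K' constEmb constEmb_injective hinvc hinvp)
        (FrobenioidThetaBiKummer.BiKummerVocabStub.ofBiKummerSetting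
          (BiKummerSetting.mkOfConnectedTemperoid X tf hZ hP NH A₀ hA₀ hA₀') pullFrac _
          fun _ => (MulEquiv.ofBijective (MonoidHom.id _) Function.bijective_id).symm) ↔
      (BiKummerSetting.mkOfConnectedTemperoid X tf hZ hP NH A₀ hA₀ hA₀').PairIsNthRootOf pullFrac ((lv : ℕ) * N) θ
        R.pair.num R.pair.den :=
  thetaPairIsRoot_ofConnectedTemperoidData_iff h Q odd_l R ιX K' constEmb constEmb_injective hinvc hinvp
    (fun A x => by rw [hF]; exact tf.pullFracModel_id A x)

end Connected

end ThetaFrobenioid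

end Literature.AnabelianGeometry.EtaleTheta

end
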